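import Literature.Topology.FourManifolds.PlumbingTreeHomology
import HarnessLib

/-!
# The homology of a plumbed union of tubes: disjoint tubes of two families meeting in acyclic boxes

Topic `Literature/Topology/FourManifolds` (fact seat
`provefact-Literature.Topology.FourManifolds.Matvey-69322e0896`, rung (H4)
`Literature.Topology.FourManifolds.Matveyev1996_partOne_and_fact_of_dualSpheres` of
`CorkDecompositionMiddleLevel.lean`).  Matveyev 1996 (arXiv:dg-ga/9505001), Proof of Theorem,
step 1, first sentence: *"Manifold `V₀` has a free fundamental group and its second homology are
generated by classes of spheres `Sᵢ` and `Pᵢ`"*, for the regular neighbourhood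
`V₀ = Nd_N(S_* ∪ P_*)` of the middle-level configuration (Kirby 1996, arXiv:math/9712231, §3).
In the tree `V₀` is read through the open set `U(t) = {H_S < t} ∪ {H_P < t}` of
`PlumbedNeighbourhoodData.lean`: a union `⋃ᵢ Aᵢ ∪ ⋃ⱼ Bⱼ` of pairwise disjoint open tubes `Aᵢ`
about the `Sᵢ` and pairwise disjoint open tubes `Bⱼ` about the `Pⱼ`, the two families meeting
in a disjoint union of chart boxes `⋃_c Q_c`, each acyclic.  This file computes the homology of
such a union in degrees `≥ 2` by the Mayer–Vietoris sequence (A. Hatcher, *Algebraic Topology*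
(2002), §2.2 p. 149; additivity Prop. 2.6), on top of the tree's iterated Mayer–Vietoris
(`PlumbingTreeHomology.lean`).  Everything is proved; no definitions, no named facts:

* `Literature.Topology.FourManifolds.bijective_sum_map_of_pairwise_disjoint` — **additivity for
  finitely many pairwise disjoint open subsets** `U₀, …, U_{N-1}` of a space and any `T` with
  `Uᵢ ⊆ T ⊆ ⋃ᵢ Uᵢ`: `x ↦ Σᵢ (Uᵢ ↪ T)_* xᵢ : Πᵢ Hₙ₊₁(Uᵢ) → Hₙ₊₁(T)` is a bijection
  (Hatcher Prop. 2.6, here as the edgeless case of `treeCover_prefix_aux`);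
  `Literature.Topology.FourManifolds.isZero_singularHomology_of_pairwise_disjoint` — so
  `Hₙ₊₁(T) = 0` when all `Hₙ₊₁(Uᵢ) = 0`;
* `Literature.Topology.FourManifolds.bijective_sum_map_plumbedUnion` — **the plumbed union**:
  for pairwise disjoint open `Aᵢ`, pairwise disjoint open `Bⱼ`, pairwise disjoint open `Q_c`
  with `Hₖ(Q_c) = 0` for `k ≥ 1` and `(⋃ Aᵢ) ∩ (⋃ Bⱼ) = ⋃ Q_c`, and `C = ⋃ Aᵢ ∪ ⋃ Bⱼ`:
  `(x, y) ↦ Σᵢ (Aᵢ ↪ C)_* xᵢ + Σⱼ (Bⱼ ↪ C)_* yⱼ : Πᵢ Hₙ₊₂(Aᵢ) × Πⱼ Hₙ₊₂(Bⱼ) → Hₙ₊₂(C)` is a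
  bijection for every `n` (degrees `≥ 2`; in degree `1` the boxes contribute the free part
  counted by the cycles of the intersection graph, not treated here).

Coefficients: any commutative ring `R` and `R`-module `M`; spaces in any universe.

## References

* A. Hatcher, *Algebraic Topology*, CUP 2002, §2.2 pp. 149–150 (Mayer–Vietoris), Prop. 2.6
  (additivity). [HatcherAT2002]
* R. Matveyev, *A decomposition of smooth simply-connected h-cobordant 4-manifolds*,
  J. Differential Geom. 44 (1996) 571–582; arXiv:dg-ga/9505001, Proof of Theorem, step 1.
  [Matveyev1996]
* R. Kirby, *Akbulut's corks and h-cobordisms of smooth, simply connected 4-manifolds*, Turkish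
  J. Math. 20 (1996) 85–93; arXiv:math/9712231, §3. [KirbyCorks1996]
-/

noncomputable section

open CategoryTheory Limits Set Function

universe u v

namespace Literature.Topology.FourManifolds

open Literature.AlgebraicTopology.SingularHomology

variable (R : Type v) [CommRing R] (M : Type v) [AddCommGroup M] [Module R M]

variable {X : Type u} [TopologicalSpace X]

/-! ### Additivity for finitely many pairwise disjoint open subsets -/

/-- **Additivity of singular homology over finitely many pairwise disjoint open subsets**
(Hatcher 2002, Prop. 2.6): let `U₀, …, U_{N-1}` be pairwise disjoint open subsets of `X` and
`T` a subset with `Uᵢ ⊆ T ⊆ ⋃ᵢ Uᵢ` (so `T = ⋃ᵢ Uᵢ`; `T` is a free parameter so that no transport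
along equalities of sets is needed at the point of use).  Then
`x ↦ Σᵢ (Uᵢ ↪ T)_* xᵢ : Πᵢ Hₙ₊₁(Uᵢ; M) → Hₙ₊₁(T; M)` is a bijection.  Proof: the edgeless case of
the iterated Mayer–Vietoris sequence along a forest (`treeCover_prefix_aux` with `parent ≡ 0`:
all the edge intersections are empty). [cite: HatcherAT2002, Prop. 2.6 and §2.2 p. 149] -/
theorem bijective_sum_map_of_pairwise_disjoint_fin {N : ℕ} (U : Fin N → Set X)
    (hUo : ∀ i, IsOpen (U i)) (hdisj : Pairwise (Disjoint on U)) {T : Set X}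
    (hUT : ∀ i, U i ⊆ T) (hTU : T ⊆ ⋃ i, U i) (n : ℕ) :
    Function.Bijective fun x : (i : Fin N) → singularHomology R M ↥(U i) (n + 1) =>
      ∑ i, singularHomology.map R M (subsetInclusion (hUT i)) (n + 1) (x i) := by
  -- the forest without edges
  let parent : Fin N → Fin N := fun j => ⟨0, Nat.lt_of_le_of_lt (Nat.zero_le _) j.isLt⟩
  have hpar : ∀ j : Fin N, 0 < j.val → (parent j).val < j.val := fun j hj => hj
  have hdisj' : ∀ i j : Fin N, i.val < j.val → i ≠ parent j → Disjoint (U i) (U j) :=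
    fun i j hij _ => hdisj (fun h => by rw [h] at hij; exact lt_irrefl _ hij)
  -- the edge intersections are empty
  have hempty : ∀ j : Fin N, 0 < j.val → U (parent j) ∩ U j = ∅ := fun j hj => by
    have hne : parent j ≠ j := fun h => by
      have h' := congrArg Fin.val h
      simp only [parent] at h'
      omega
    exact Set.disjoint_iff_inter_eq_empty.1 (hdisj hne)
  have hzero : ∀ j : Fin N, 0 < j.val → ∀ q,
      IsZero (singularHomology R M ↥(U (parent j) ∩ U j) q) := by
    intro j hj q
    haveI : IsEmpty ↥(U (parent j) ∩ U j) := by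
      rw [hempty j hj]
      exact Set.isEmpty_coe_sort.2 rfl
    exact (isZero_csingularHomology_of_isEmpty R M q).of_iso
      (csingularHomology.compIso R M _ q).symm
  -- the prefixes `S r = ⋃_{i < r} U i`
  have hUS : ∀ (i : Fin N) (r : ℕ), i.val < r → U i ⊆ ⋃ i : Fin N, ⋃ (_ : i.val < r), U i :=
    fun i r h => Set.subset_iUnion₂ (s := fun (i : Fin N) (_ : i.val < r) => U i) i h
  have hSU : ∀ (r : ℕ) (x : X), x ∈ (⋃ i : Fin N, ⋃ (_ : i.val < r), U i) →
      ∃ i : Fin N, i.val < r ∧ x ∈ U i := fun r x hx => by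
    simpa only [Set.mem_iUnion, exists_prop] using hx
  obtain ⟨hinj, hsurj⟩ := treeCover_prefix_aux R M U hUo parent hpar hdisj'
    (fun r => ⋃ i : Fin N, ⋃ (_ : i.val < r), U i)
    (fun r => isOpen_iUnion fun i => isOpen_iUnion fun _ => hUo i) hUS hSU n
    (fun j hj => hzero j hj (n + 1))
    (fun j hj T' hT' => ⟨fun g g' _ => (hzero j hj n).eq_of_tgt g g'⟩) N le_rfl
  -- `S N = T`
  have hSN : (⋃ i : Fin N, ⋃ (_ : i.val < N), U i) = T := by
    refine Subset.antisymm (fun x hx => ?_) fun x hx => ?_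
    · obtain ⟨i, -, hxi⟩ := hSU N x hx
      exact hUT i hxi
    · obtain ⟨i, hxi⟩ := mem_iUnion.1 (hTU hx)
      exact hUS i N i.2 hxi
  let e : ↥(⋃ i : Fin N, ⋃ (_ : i.val < N), U i) ≃ₜ ↥T := Homeomorph.setCongr hSN
  have hfac : ∀ i : Fin N, (subsetInclusion (hUT i) : C(↥(U i), ↥T)) =
      (e : C(↥(⋃ i : Fin N, ⋃ (_ : i.val < N), U i), ↥T)).comp
        (subsetInclusion (hUS i N i.2)) := fun i => by
    ext x
    rfl
  have hΦ : ∀ x : (i : Fin N) → singularHomology R M ↥(U i) (n + 1),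
      (∑ i, singularHomology.map R M (subsetInclusion (hUT i)) (n + 1) (x i)) =
        singularHomology.map R M (e : C(↥(⋃ i : Fin N, ⋃ (_ : i.val < N), U i), ↥T)) (n + 1)
          (∑ i, if h : i.val < N then
            singularHomology.map R M (subsetInclusion (hUS i N h)) (n + 1) (x i) else 0) := by
    intro x
    rw [map_sum]
    refine Finset.sum_congr rfl fun i _ => ?_
    rw [dif_pos i.2, hfac i, singularHomology.map_comp, ModuleCat.comp_apply]
  -- `e_*` and `e⁻¹_*` are mutually inverse
  have hsymm : (e.symm : C(↥T, ↥(⋃ i : Fin N, ⋃ (_ : i.val < N), U i))).comp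
      (e : C(↥(⋃ i : Fin N, ⋃ (_ : i.val < N), U i), ↥T)) = ContinuousMap.id _ := by
    ext x
    exact congrArg Subtype.val (e.symm_apply_apply x)
  have hsymm' : (e : C(↥(⋃ i : Fin N, ⋃ (_ : i.val < N), U i), ↥T)).comp
      (e.symm : C(↥T, ↥(⋃ i : Fin N, ⋃ (_ : i.val < N), U i))) = ContinuousMap.id _ := by
    ext x
    exact congrArg Subtype.val (e.apply_symm_apply x)
  have hleft : ∀ z, singularHomology.map R M
      (e.symm : C(↥T, ↥(⋃ i : Fin N, ⋃ (_ : i.val < N), U i))) (n + 1)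
      (singularHomology.map R M (e : C(↥(⋃ i : Fin N, ⋃ (_ : i.val < N), U i), ↥T)) (n + 1) z) =
        z := fun z => by
    rw [← ModuleCat.comp_apply, ← singularHomology.map_comp, hsymm, singularHomology.map_id,
      ModuleCat.id_apply]
  have hright : ∀ y, singularHomology.map R M
      (e : C(↥(⋃ i : Fin N, ⋃ (_ : i.val < N), U i), ↥T)) (n + 1)
      (singularHomology.map R M (e.symm : C(↥T, ↥(⋃ i : Fin N, ⋃ (_ : i.val < N), U i)))
        (n + 1) y) = y := fun y => by
    rw [← ModuleCat.comp_apply, ← singularHomology.map_comp, hsymm', singularHomology.map_id,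
      ModuleCat.id_apply]
  refine ⟨fun x x' hxx' => ?_, fun y => ?_⟩
  · dsimp only at hxx'
    rw [hΦ, hΦ] at hxx'
    have h := congrArg (singularHomology.map R M
      (e.symm : C(↥T, ↥(⋃ i : Fin N, ⋃ (_ : i.val < N), U i))) (n + 1)) hxx'
    rw [hleft, hleft] at h
    exact hinj x x' (fun i hi => by omega) (fun i hi => by omega) h
  · obtain ⟨x, -, hx⟩ := hsurj (singularHomology.map R M
      (e.symm : C(↥T, ↥(⋃ i : Fin N, ⋃ (_ : i.val < N), U i))) (n + 1) y)
    refine ⟨x, ?_⟩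
    change (∑ i, singularHomology.map R M (subsetInclusion (hUT i)) (n + 1) (x i)) = y
    rw [hΦ, hx, hright]

/-- **Additivity of singular homology over a finite family of pairwise disjoint open subsets**
(Hatcher 2002, Prop. 2.6), for an arbitrary finite index type: with `Uᵢ ⊆ T ⊆ ⋃ᵢ Uᵢ`,
`x ↦ Σᵢ (Uᵢ ↪ T)_* xᵢ : Πᵢ Hₙ₊₁(Uᵢ; M) → Hₙ₊₁(T; M)` is a bijection (the case of `Fin N`,
`bijective_sum_map_of_pairwise_disjoint_fin`, reindexed along an enumeration).
[cite: HatcherAT2002, Prop. 2.6] -/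
theorem bijective_sum_map_of_pairwise_disjoint {ι : Type*} [Fintype ι] (U : ι → Set X)
    (hUo : ∀ i, IsOpen (U i)) (hdisj : Pairwise (Disjoint on U)) {T : Set X}
    (hUT : ∀ i, U i ⊆ T) (hTU : T ⊆ ⋃ i, U i) (n : ℕ) :
    Function.Bijective fun x : (i : ι) → singularHomology R M ↥(U i) (n + 1) =>
      ∑ i, singularHomology.map R M (subsetInclusion (hUT i)) (n + 1) (x i) := by
  classical
  set e := Fintype.equivFin ι with he
  have hTU' : T ⊆ ⋃ k, U (e.symm k) := fun x hx => by
    obtain ⟨i, hi⟩ := mem_iUnion.1 (hTU hx)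
    exact mem_iUnion.2 ⟨e i, by rwa [e.symm_apply_apply]⟩
  have hdisj' : Pairwise (Disjoint on fun k => U (e.symm k)) :=
    fun k k' hkk' => hdisj fun h => hkk' (e.symm.injective h)
  have hbij := bijective_sum_map_of_pairwise_disjoint_fin R M (fun k => U (e.symm k))
    (fun k => hUo _) hdisj' (fun k => hUT _) hTU' n
  have key : (fun x : (i : ι) → singularHomology R M ↥(U i) (n + 1) =>
      ∑ i, singularHomology.map R M (subsetInclusion (hUT i)) (n + 1) (x i)) =
      (fun x' : (k : Fin (Fintype.card ι)) → singularHomology R M ↥(U (e.symm k)) (n + 1) =>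
        ∑ k, singularHomology.map R M (subsetInclusion (hUT (e.symm k))) (n + 1) (x' k)) ∘
      (Equiv.piCongrLeft' (fun i => singularHomology R M ↥(U i) (n + 1)) e) := by
    funext x
    simp only [Function.comp_apply, Equiv.piCongrLeft'_apply]
    exact (e.symm.sum_comp (fun i => singularHomology.map R M (subsetInclusion (hUT i)) (n + 1)
      (x i))).symm
  rw [key]
  exact hbij.comp (Equiv.bijective _)

/-- If finitely many pairwise disjoint open subsets `Uᵢ` of `X` all have `Hₙ₊₁(Uᵢ; M) = 0`, then
so has any `T` with `Uᵢ ⊆ T ⊆ ⋃ᵢ Uᵢ` (additivity, Hatcher 2002, Prop. 2.6).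
[cite: HatcherAT2002, Prop. 2.6] -/
theorem isZero_singularHomology_of_pairwise_disjoint {ι : Type*} [Fintype ι] (U : ι → Set X)
    (hUo : ∀ i, IsOpen (U i)) (hdisj : Pairwise (Disjoint on U)) {T : Set X}
    (hUT : ∀ i, U i ⊆ T) (hTU : T ⊆ ⋃ i, U i) (n : ℕ)
    (hU : ∀ i, IsZero (singularHomology R M ↥(U i) (n + 1))) :
    IsZero (singularHomology R M ↥T (n + 1)) := by
  have hbij := bijective_sum_map_of_pairwise_disjoint R M U hUo hdisj hUT hTU n
  have hx0 : ∀ (i : ι) (z : singularHomology R M ↥(U i) (n + 1)), z = 0 := fun i z => by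
    have h := congrArg (fun φ : singularHomology R M ↥(U i) (n + 1) ⟶
      singularHomology R M ↥(U i) (n + 1) => φ z) ((hU i).eq_of_src (𝟙 _) 0)
    simpa using h
  have hall : ∀ y : singularHomology R M ↥T (n + 1), y = 0 := fun y => by
    obtain ⟨x, rfl⟩ := hbij.2 y
    exact Finset.sum_eq_zero fun i _ => by rw [hx0 i (x i), map_zero]
  haveI : Subsingleton (singularHomology R M ↥T (n + 1)) :=
    ⟨fun a b => (hall a).trans (hall b).symm⟩
  exact ModuleCat.isZero_of_subsingleton _

/-! ### The plumbed union -/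

/-- **The homology of a plumbed union of tubes in degrees `≥ 2`** (Mayer–Vietoris, Hatcher
2002, §2.2 p. 149, with additivity, Prop. 2.6; the computation behind Matveyev's *"its second
homology are generated by classes of spheres `Sᵢ` and `Pᵢ`"*, 1996, step 1, for the regular
neighbourhood of the middle-level configuration).  Let `Aᵢ` (`i ∈ ι`, finite) be pairwise
disjoint open subsets of `X` (the tubes about the spheres of the first family), `Bⱼ`
(`j ∈ ι'`, finite) pairwise disjoint open subsets (the tubes about the second family), and
`Q_c` (`c ∈ κ`, finite) pairwise disjoint open subsets with `Hₖ(Q_c; M) = 0` for all `k ≥ 1`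
(the chart boxes at the crossings), such that `(⋃ᵢ Aᵢ) ∩ (⋃ⱼ Bⱼ) = ⋃_c Q_c`; let `C` be a subset with
`Aᵢ, Bⱼ ⊆ C ⊆ ⋃ᵢ Aᵢ ∪ ⋃ⱼ Bⱼ`.  Then for every `n`,
`(x, y) ↦ Σᵢ (Aᵢ ↪ C)_* xᵢ + Σⱼ (Bⱼ ↪ C)_* yⱼ : Πᵢ Hₙ₊₂(Aᵢ) × Πⱼ Hₙ₊₂(Bⱼ) → Hₙ₊₂(C)` is a
bijection: the binary Mayer–Vietoris sequence of `C = (⋃ Aᵢ) ∪ (⋃ Bⱼ)`, whose intersection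
`⋃ Q_c` has `Hₙ₊₂ = Hₙ₊₁ = 0` by additivity, composed with additivity for each family.
[cite: HatcherAT2002, §2.2 p. 149 and Prop. 2.6]
[cite: Matveyev1996, Proof of Theorem, step 1 (arXiv p. 1)] -/
theorem bijective_sum_map_plumbedUnion {ι ι' κ : Type*} [Fintype ι] [Fintype ι'] [Fintype κ]
    (A : ι → Set X) (B : ι' → Set X)
    (Q : κ → Set X) (hAo : ∀ i, IsOpen (A i)) (hBo : ∀ j, IsOpen (B j))
    (hQo : ∀ c, IsOpen (Q c)) (hAd : Pairwise (Disjoint on A)) (hBd : Pairwise (Disjoint on B))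
    (hQd : Pairwise (Disjoint on Q))
    (hAB : (⋃ i, A i) ∩ (⋃ j, B j) = ⋃ c, Q c)
    (hQ : ∀ c (k : ℕ), IsZero (singularHomology R M ↥(Q c) (k + 1)))
    {C : Set X} (hAC : ∀ i, A i ⊆ C) (hBC : ∀ j, B j ⊆ C) (hC : C ⊆ (⋃ i, A i) ∪ (⋃ j, B j))
    (n : ℕ) :
    Function.Bijective fun p : ((i : ι) → singularHomology R M ↥(A i) (n + 2)) ×
        ((j : ι') → singularHomology R M ↥(B j) (n + 2)) =>
      (∑ i, singularHomology.map R M (subsetInclusion (hAC i)) (n + 2) (p.1 i)) +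
        ∑ j, singularHomology.map R M (subsetInclusion (hBC j)) (n + 2) (p.2 j) := by
  -- the binary step
  have hA'C : (⋃ i, A i) ⊆ C := iUnion_subset hAC
  have hB'C : (⋃ j, B j) ⊆ C := iUnion_subset hBC
  have hDA : (⋃ c, Q c) ⊆ ⋃ i, A i := fun x hx => (hAB.symm ▸ hx : x ∈ (⋃ i, A i) ∩ ⋃ j, B j).1
  have hDB : (⋃ c, Q c) ⊆ ⋃ j, B j := fun x hx => (hAB.symm ▸ hx : x ∈ (⋃ i, A i) ∩ ⋃ j, B j).2
  have hD : (⋃ i, A i) ∩ (⋃ j, B j) ⊆ ⋃ c, Q c := hAB.subset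
  have hQD : ∀ c, Q c ⊆ ⋃ c, Q c := fun c => subset_iUnion Q c
  have hzD : ∀ k, IsZero (singularHomology R M ↥(⋃ c, Q c) (k + 1)) := fun k =>
    isZero_singularHomology_of_pairwise_disjoint R M Q hQo hQd hQD Subset.rfl k fun c => hQ c k
  have hbin := bijective_mayerVietoris_subsets R M (isOpen_iUnion hAo) (isOpen_iUnion hBo)
    hA'C hB'C hC hDA hDB hD (n + 1) (hzD (n + 1))
    ⟨fun g g' _ => (hzD n).eq_of_tgt g g'⟩
  -- additivity for each family
  have hAu : ∀ i, A i ⊆ ⋃ i, A i := fun i => subset_iUnion A i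
  have hBu : ∀ j, B j ⊆ ⋃ j, B j := fun j => subset_iUnion B j
  have hbijA := bijective_sum_map_of_pairwise_disjoint R M A hAo hAd hAu Subset.rfl (n + 1)
  have hbijB := bijective_sum_map_of_pairwise_disjoint R M B hBo hBd hBu Subset.rfl (n + 1)
  -- composing
  have hfacA : ∀ i, (subsetInclusion (hAC i) : C(↥(A i), ↥C)) =
      (subsetInclusion hA'C).comp (subsetInclusion (hAu i)) := fun i => by
    ext x
    rfl
  have hfacB : ∀ j, (subsetInclusion (hBC j) : C(↥(B j), ↥C)) =
      (subsetInclusion hB'C).comp (subsetInclusion (hBu j)) := fun j => by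
    ext x
    rfl
  have key : (fun p : ((i : ι) → singularHomology R M ↥(A i) (n + 2)) ×
        ((j : ι') → singularHomology R M ↥(B j) (n + 2)) =>
      (∑ i, singularHomology.map R M (subsetInclusion (hAC i)) (n + 2) (p.1 i)) +
        ∑ j, singularHomology.map R M (subsetInclusion (hBC j)) (n + 2) (p.2 j)) =
      (fun q : singularHomology R M ↥(⋃ i, A i) (n + 2) ×
          singularHomology R M ↥(⋃ j, B j) (n + 2) =>
        singularHomology.map R M (subsetInclusion hA'C) (n + 2) q.1 +
          singularHomology.map R M (subsetInclusion hB'C) (n + 2) q.2) ∘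
      (fun p : ((i : ι) → singularHomology R M ↥(A i) (n + 2)) ×
          ((j : ι') → singularHomology R M ↥(B j) (n + 2)) =>
        ((∑ i, singularHomology.map R M (subsetInclusion (hAu i)) (n + 2) (p.1 i)),
          ∑ j, singularHomology.map R M (subsetInclusion (hBu j)) (n + 2) (p.2 j))) := by
    funext p
    simp only [Function.comp_apply, map_sum, hfacA, hfacB, singularHomology.map_comp,
      ModuleCat.comp_apply]
  rw [key]
  refine hbin.comp ?_
  exact ⟨fun p p' h => Prod.ext (hbijA.1 (congrArg Prod.fst h)) (hbijB.1 (congrArg Prod.snd h)),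
    fun q => by
      obtain ⟨x, hx⟩ := hbijA.2 q.1
      obtain ⟨y, hy⟩ := hbijB.2 q.2
      exact ⟨(x, y), Prod.ext hx hy⟩⟩

end Literature.Topology.FourManifolds

end
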